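import Literature.Probability.LatticeModels.FKPrimitive
import HarnessLib

/-!
# The FK-Ising observable of a family of configurations (the conditional observable of a slit domain)

Topic `Literature/Probability/LatticeModels`; part of the discharge programme for the named fact
`fkIsing_rsw` (Duminil-Copin–Hongler–Nolin 2011, Thm. 1 / Duminil-Copin–Smirnov 2012, Thm. 3.16),
whose last missing input is Duminil-Copin's slit-domain lower bound (proof of Lemma 10.7 of
*Parafermionic observables and their applications to planar statistical physics models*, Ensaios
Mat. 25 (2013); DCHN 2011, proof of Lemma 15): "`φ^{γ(T),d_n}_{R ∖ γ[0,T]}(z ↔ wired arc) ≥ c₄/√r`",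
obtained from the fermionic observable **of the slit domain** `R ∖ γ[0,T]`. The tree encodes
Dobrushin data by continuum sets (`DiscreteDobrushin`), and a two-sided slit is not such a datum.
This file starts the observable theory *relative to a family of configurations* instead: for
admissible data `D` and a finite family `C` of configurations of the interface graph (later: the
prefix cylinder `{ω | ω ∖ U = ζ₀}` of `FKExplorationDomainMarkov`, i.e. the conditional law given
`γ[0,n]`), the **family dart observable** `dartObsOn D hD C q` and the **family vertex observable**
`vertexObsOn D hD C e` are the `C`-weighted averages (critical FK weights wired on `A`, normalised by
the family partition function `famZ`) of the spin-`½` phases of the darts resp. passages of the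
exploration — for `C` = all configurations these are `dartObs` and `F` of `SHolomorphicityProof.lean`.

Everything Smirnov's theory needs is either *per configuration* or the *per-pair* identity of
Lemma 4.5 (`pair_weighted_free`, `DartFlux.lean`), so it transfers to any family:

* **Lemma 4.5 on families closed under toggling `e`** (`IsToggleClosed C e`: `ω ∈ C ⇒ ω ∪ {e},
  ω ∖ {e} ∈ C`; `sum_toggle_pair`): `dartObsOn_add_partner`, `dartObsOn_out` (arrivals resp.
  departures at an interior edge `e = cTgt p` add up to `κ F_C(e)`), hence the closedness of the
  fluxes `dartFluxOn = ‖dartObsOn‖²` at such edges (`dartFluxOn_closed_toggle`, Pythagoras on the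
  orthogonal lines of Lemma 4.1, `dartObsOn_mem_line`);
* **forced edges** (Lemma 4.11): if `cTgt q` is open (resp. closed) in every configuration of the
  family, the passages through `q` and its forced successor correspond, `dartObsOn` picks up the unit
  factor `quarterPhase (∓1)` and the fluxes agree (`dartObsOn_follow_of_forall_mem`,
  `dartObsOn_cross_of_forall_not_mem`, `dartFluxOn_follow_eq`, `dartFluxOn_cross_eq`) — this covers
  the `A`–`A` edges, the edges touching `B`, **and the revealed edges of an exploration prefix**;
* darts at `B`-sites vanish (`dartObsOn_eq_zero_of_mem_zdArcB`), the start dart is `1`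
  (`dartObsOn_startCorner`), `dartFluxOn ≤ 1` (`dartFluxOn_le_one`: a dart is used at most once);
* **closedness of the flux form** on the inner faces (`isCornerClosedOn_dartFluxOn`) as soon as
  every edge with two inner faces is *adapted* to the family (`IsAdaptedEdge`: `A`–`A`, or touching
  `B`, or forced in `C`, or toggle-closed), and the **family primitive**
  (`exists_isFamilyPrimitive`: `Hb (cFace q) - Hw q.1 = dartFluxOn C q`, by the discrete Poincaré
  lemma `exists_potential_of_holeFree` on the same hole-free set of inner faces).

No named fact is introduced; nothing here assumes `fkIsing_rsw`.

## References

* S. Smirnov, *Conformal invariance in random cluster models. I*, Ann. of Math. 172 (2010)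
  1435–1467: Lemma 3.6, Lemma 4.1, Lemma 4.5 with Remarks 4.6–4.7, Lemma 4.11 — bib key `Smirnov2010`.
* H. Duminil-Copin, S. Smirnov, *Conformal invariance of lattice models*, Clay Math. Proc. 15
  (2012), §6.2, proof of Lemma 6.6 ("the slit domain … is again a Dobrushin domain") — bib key
  `DuminilCopinSmirnov2012Clay`.
* H. Duminil-Copin, *Parafermionic observables and their applications to planar statistical physics
  models*, Ensaios Matemáticos 25 (2013), Chap. 10, proof of Lemma 10.7.
* H. Duminil-Copin, C. Hongler, P. Nolin, Comm. Pure Appl. Math. 64 (2011), §4, proof of Lemma 15 —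
  bib key `DuminilCopinHonglerNolin2011`.
-/

noncomputable section

namespace Literature.Probability.LatticeModels

open Complex Finset

variable {D : DiscreteDobrushin}

/-! ### Families of configurations, their weights, and the per-configuration dart sums -/

section Defs

variable (D) [Fintype (meshDomain D.Ω D.δ)]

open scoped Classical in
/-- The **family partition function**: the total critical FK weight (wired on `A`) of the
configurations of the family `C`. [cite: Smirnov2010, §2.2 eq. (2.2)] -/
def famZ (C : Finset (Finset (Sym2 (meshDomain D.Ω D.δ)))) : ℝ :=
  ∑ ω ∈ C, rcWeight D.interfaceGraph criticalFKIsingParam 2 (Subtype.val ⁻¹' D.zdArcA) ω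

variable (hD : D.IsZdAdmissible)

open scoped Classical in
/-- The **dart sum of one configuration**: the sum of the spin-`½` weights
`quarterPhase (turnCount j) = e^{-iπ C_j/4}` over the times `j` before the exit at which the
exploration of the completed configuration of `ω` is at the coded corner `q` (at most one such time).
[cite: Smirnov2010, §4 eq. (4.1)] -/
def dartSum (ω : Finset (Sym2 (meshDomain D.Ω D.δ))) (q : Site 2 × Fin 4) : ℂ :=
  ∑ j ∈ (Finset.range (DiscreteDobrushin.exitTime hD (liftConfig D.Ω D.δ ω))).filter
      (fun j => cornerOrbit (D.bcBondConfig (liftConfig D.Ω D.δ ω)) (DiscreteDobrushin.startCorner hD) j = q),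
    quarterPhase (turnCount (D.bcBondConfig (liftConfig D.Ω D.δ ω)) (DiscreteDobrushin.startCorner hD) j)

open scoped Classical in
/-- The **family dart observable** at the coded corner `q`: the `C`-average of the dart sums
(for `C` = all configurations this is `dartObs D hD q`; for a prefix cylinder it is the dart
observable of the slit domain, i.e. the conditional expectation given the prefix).
[cite: Smirnov2010, §4 eq. (4.1); DuminilCopinSmirnov2012Clay, §6.2, proof of Lemma 6.6] -/
def dartObsOn (C : Finset (Finset (Sym2 (meshDomain D.Ω D.δ)))) (q : Site 2 × Fin 4) : ℂ :=
  ∑ ω ∈ C, (((rcWeight D.interfaceGraph criticalFKIsingParam 2 (Subtype.val ⁻¹' D.zdArcA) ω / famZ D C : ℝ)) : ℂ) *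
    dartSum D hD ω q

open scoped Classical in
/-- The **family vertex observable** at the edge `e` of `ℤ²` (a medial vertex): the `C`-average of
the passage sums of the exploration (for `C` = all configurations this is H21's
`fkIsingObservable D p_c e`, `fkIsingObservable_eq_sum`). [cite: Smirnov2010, §2.2 eq. (2.2)] -/
def vertexObsOn (C : Finset (Finset (Sym2 (meshDomain D.Ω D.δ)))) (e : MedialVertex) : ℂ :=
  ∑ ω ∈ C, (((rcWeight D.interfaceGraph criticalFKIsingParam 2 (Subtype.val ⁻¹' D.zdArcA) ω / famZ D C : ℝ)) : ℂ) *
    passageSum (explorationList (D.bcBondConfig (liftConfig D.Ω D.δ ω)) (DiscreteDobrushin.startCorner hD)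
      (DiscreteDobrushin.exitTime hD (liftConfig D.Ω D.δ ω))) D.δ (1 / 2) e

open scoped Classical in
/-- The **family dart flux** `|F_C(q)|²`, the increment of the family primitive across `q`.
[cite: Smirnov2010, Lemma 3.6 eq. (3.3)] -/
def dartFluxOn (C : Finset (Finset (Sym2 (meshDomain D.Ω D.δ)))) (q : Site 2 × Fin 4) : ℝ :=
  ‖dartObsOn D hD C q‖ ^ 2

end Defs

/-! ### Weights -/

section Weights

variable [Fintype (meshDomain D.Ω D.δ)]

open scoped Classical in
/-- `0 < p_c < 1`. [cite: Smirnov2010, §2.1] -/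
theorem criticalFKIsingParam_pos_lt_one : 0 < criticalFKIsingParam ∧ criticalFKIsingParam < 1 := by
  unfold criticalFKIsingParam
  have h2 : 0 < Real.sqrt 2 := Real.sqrt_pos.2 two_pos
  refine ⟨by positivity, ?_⟩
  rw [div_lt_one (by positivity)]
  linarith

open scoped Classical in
/-- Critical FK weights are positive. [cite: Grimmett2006, §1.2 eq. (1.2)] -/
theorem rcWeight_critical_pos (ω : Finset (Sym2 (meshDomain D.Ω D.δ))) :
    0 < rcWeight D.interfaceGraph criticalFKIsingParam 2 (Subtype.val ⁻¹' D.zdArcA) ω := by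
  obtain ⟨h0, h1⟩ := criticalFKIsingParam_pos_lt_one
  unfold rcWeight
  have : 0 < 1 - criticalFKIsingParam := by linarith
  positivity

open scoped Classical in
/-- The family partition function of a nonempty family is positive. [cite: Grimmett2006, §1.2] -/
theorem famZ_pos {C : Finset (Finset (Sym2 (meshDomain D.Ω D.δ)))} (hC : C.Nonempty) : 0 < famZ D C :=
  Finset.sum_pos (fun ω _ => rcWeight_critical_pos ω) hC

open scoped Classical in
/-- The family partition function is nonnegative. [cite: Grimmett2006, §1.2] -/
theorem famZ_nonneg (C : Finset (Finset (Sym2 (meshDomain D.Ω D.δ)))) : 0 ≤ famZ D C :=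
  Finset.sum_nonneg fun ω _ => (rcWeight_critical_pos ω).le

open scoped Classical in
/-- The normalised weights of a nonempty family sum to one. [cite: Grimmett2006, §1.2] -/
theorem sum_weight_div_famZ {C : Finset (Finset (Sym2 (meshDomain D.Ω D.δ)))} (hC : C.Nonempty) :
    ∑ ω ∈ C, rcWeight D.interfaceGraph criticalFKIsingParam 2 (Subtype.val ⁻¹' D.zdArcA) ω / famZ D C = 1 := by
  rw [← Finset.sum_div, ← famZ, div_self (famZ_pos hC).ne']

open scoped Classical in
/-- Normalised weights are nonnegative. [cite: Grimmett2006, §1.2] -/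
theorem weight_div_famZ_nonneg (C : Finset (Finset (Sym2 (meshDomain D.Ω D.δ)))) (ω : Finset (Sym2 (meshDomain D.Ω D.δ))) :
    0 ≤ rcWeight D.interfaceGraph criticalFKIsingParam 2 (Subtype.val ⁻¹' D.zdArcA) ω / famZ D C :=
  div_nonneg (rcWeight_critical_pos ω).le (famZ_nonneg C)

end Weights

/-! ### The dart sum of one configuration -/

section DartSum

variable (hD : D.IsZdAdmissible)

open scoped Classical in
/-- A dart is used at most once before the exit: the filter of times at `q` has at most one
element. [cite: Smirnov2010, §2.2] -/
theorem card_filter_cornerOrbit_le_one (ω₀ : Percolation.BondConfig (Site 2)) (q : Site 2 × Fin 4) :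
    ((Finset.range (DiscreteDobrushin.exitTime hD ω₀)).filter
      (fun j => cornerOrbit (D.bcBondConfig ω₀) (DiscreteDobrushin.startCorner hD) j = q)).card ≤ 1 := by
  rw [Finset.card_le_one]
  intro i hi j hj
  rw [Finset.mem_filter, Finset.mem_range] at hi hj
  by_contra hne
  have hc₀ := DiscreteDobrushin.isStartCorner_startCorner hD
  rcases Nat.lt_or_gt_of_ne hne with h | h
  · exact cornerOrbit_ne hD hc₀ h (fun k hk => DiscreteDobrushin.isInnerFace_of_lt_exitTime hD ω₀ (hk.trans hj.1))
      (hi.2.trans hj.2.symm)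
  · exact cornerOrbit_ne hD hc₀ h (fun k hk => DiscreteDobrushin.isInnerFace_of_lt_exitTime hD ω₀ (hk.trans hi.1))
      (hj.2.trans hi.2.symm)

open scoped Classical in
/-- `‖dartSum ω q‖ ≤ 1`. [cite: Smirnov2010, §2.2] -/
theorem norm_dartSum_le_one (ω : Finset (Sym2 (meshDomain D.Ω D.δ))) (q : Site 2 × Fin 4) :
    ‖dartSum D hD ω q‖ ≤ 1 := by
  classical
  unfold dartSum
  refine (norm_sum_le _ _).trans ?_
  calc _ ≤ ∑ j ∈ (Finset.range (DiscreteDobrushin.exitTime hD (liftConfig D.Ω D.δ ω))).filter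
        (fun j => cornerOrbit (D.bcBondConfig (liftConfig D.Ω D.δ ω)) (DiscreteDobrushin.startCorner hD) j = q), (1 : ℝ) :=
        Finset.sum_le_sum fun j _ => by rw [norm_quarterPhase]
    _ ≤ 1 := by
        rw [Finset.sum_const, nsmul_eq_mul, mul_one]
        exact_mod_cast card_filter_cornerOrbit_le_one hD (liftConfig D.Ω D.δ ω) q

open scoped Classical in
/-- The dart sum lies on the line of the dart's direction. [cite: Smirnov2010, Lemma 4.1] -/
theorem dartSum_mem_line (ω : Finset (Sym2 (meshDomain D.Ω D.δ))) (q : Site 2 × Fin 4) :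
    ∃ t : ℝ, dartSum D hD ω q = t * quarterPhase (dartDir (DiscreteDobrushin.startCorner hD) q) := by
  classical
  unfold dartSum
  refine exists_real_sum _ _ _ fun j hj => ?_
  rw [Finset.mem_filter] at hj
  refine ⟨(-1) ^ (turnCount (D.bcBondConfig (liftConfig D.Ω D.δ ω)) (DiscreteDobrushin.startCorner hD) j / 4).natAbs, ?_⟩
  rw [quarterPhase_turnCount, hj.2]; push_cast; rfl

open scoped Classical in
/-- The dart sum at a dart whose vertex is on the free arc vanishes (the exploration never turns
around a `B`-site). [cite: Smirnov2010, Lemma 3.10 and Lemma 4.11] -/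
theorem dartSum_eq_zero_of_mem_zdArcB (ω : Finset (Sym2 (meshDomain D.Ω D.δ))) {q : Site 2 × Fin 4}
    (hq : q.1 ∈ D.zdArcB) : dartSum D hD ω q = 0 := by
  classical
  unfold dartSum
  refine Finset.sum_eq_zero fun j hj => ?_
  rw [Finset.mem_filter] at hj
  exact absurd hq (hj.2 ▸ cornerOrbit_fst_not_mem_zdArcB hD (DiscreteDobrushin.isStartCorner_startCorner hD) _ j)

open scoped Classical in
/-- The dart sum at the start corner is `1`. [cite: Smirnov2010, proof of Lemma 4.11] -/
theorem dartSum_startCorner (ω : Finset (Sym2 (meshDomain D.Ω D.δ))) :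
    dartSum D hD ω (DiscreteDobrushin.startCorner hD) = 1 := by
  classical
  have hc₀ := DiscreteDobrushin.isStartCorner_startCorner hD
  unfold dartSum
  set ω₀ := liftConfig D.Ω D.δ ω
  have hfilt : (Finset.range (DiscreteDobrushin.exitTime hD ω₀)).filter
      (fun j => cornerOrbit (D.bcBondConfig ω₀) (DiscreteDobrushin.startCorner hD) j = DiscreteDobrushin.startCorner hD) =
      {0} := by
    ext j
    simp only [Finset.mem_filter, Finset.mem_range, Finset.mem_singleton]
    constructor
    · rintro ⟨hj, h⟩
      by_contra hne
      have hlt : 0 < j := Nat.pos_of_ne_zero hne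
      exact cornerOrbit_ne hD hc₀ hlt (fun k hk => DiscreteDobrushin.isInnerFace_of_lt_exitTime hD ω₀ (by omega))
        (by rw [cornerOrbit_zero]; exact h.symm)
    · rintro rfl
      exact ⟨DiscreteDobrushin.exitTime_pos hD ω₀, cornerOrbit_zero⟩
  rw [hfilt, Finset.sum_singleton, turnCount_zero, quarterPhase]
  simp

open scoped Classical in
/-- **Following a forced-open edge, per configuration**: if `cTgt q` is open in the completed
configuration and `q` has an inner face, the dart sum at the forced successor is
`quarterPhase (-1)` times the dart sum at `q`. [cite: Smirnov2010, proof of Lemma 4.11] -/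
theorem dartSum_follow (ω : Finset (Sym2 (meshDomain D.Ω D.δ))) {q : Site 2 × Fin 4}
    (hqf : D.IsInnerFace (cFace q)) (hopen : cTgt q ∈ D.bcBondConfig (liftConfig D.Ω D.δ ω)) :
    dartSum D hD ω (q.1 + cornerUnit (q.2 + 1), q.2 + 3) = quarterPhase (-1) * dartSum D hD ω q := by
  unfold dartSum
  have hnext : nextCorner (D.bcBondConfig (liftConfig D.Ω D.δ ω)) q = (q.1 + cornerUnit (q.2 + 1), q.2 + 3) :=
    nextCorner_of_mem hopen
  have hq'f : D.IsInnerFace (cFace (nextCorner (D.bcBondConfig (liftConfig D.Ω D.δ ω)) q)) := by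
    rw [cFace_nextCorner_of_mem hopen]; exact hqf
  rw [← hnext, sum_filter_nextCorner hD _ hqf hq'f, turnSign_of_mem hopen]

open scoped Classical in
/-- **Crossing a forced-closed edge, per configuration.** [cite: Smirnov2010, proof of Lemma 4.11] -/
theorem dartSum_cross (ω : Finset (Sym2 (meshDomain D.Ω D.δ))) {q : Site 2 × Fin 4}
    (hqf : D.IsInnerFace (cFace q)) (hq'f : D.IsInnerFace (faceAt q.1 (q.2 + 1)))
    (hclosed : cTgt q ∉ D.bcBondConfig (liftConfig D.Ω D.δ ω)) :
    dartSum D hD ω (q.1, q.2 + 1) = quarterPhase 1 * dartSum D hD ω q := by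
  unfold dartSum
  have hnext : nextCorner (D.bcBondConfig (liftConfig D.Ω D.δ ω)) q = (q.1, q.2 + 1) := nextCorner_of_not_mem hclosed
  have hq'f' : D.IsInnerFace (cFace (nextCorner (D.bcBondConfig (liftConfig D.Ω D.δ ω)) q)) := by
    rw [cFace_nextCorner_of_not_mem hclosed]; exact hq'f
  rw [← hnext, sum_filter_nextCorner hD _ hqf hq'f', turnSign_of_not_mem hclosed]

end DartSum

/-! ### Basic properties of the family observables -/

section Basic

variable [Fintype (meshDomain D.Ω D.δ)] (hD : D.IsZdAdmissible)

open scoped Classical in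
/-- For the family of all configurations the family dart observable is `dartObs`. [cite: Smirnov2010, §4 eq. (4.1)] -/
theorem dartObsOn_powerset (q : Site 2 × Fin 4) :
    dartObsOn D hD D.interfaceGraph.edgeFinset.powerset q = dartObs D hD q := by
  classical
  unfold dartObsOn dartObs dartSum famZ
  rfl

open scoped Classical in
/-- For the family of all configurations the family vertex observable is H21's `fkIsingObservable`
at `p_c`. [cite: Smirnov2010, §2.2 eq. (2.2)] -/
theorem vertexObsOn_powerset (e : MedialVertex) :
    vertexObsOn D hD D.interfaceGraph.edgeFinset.powerset e = fkIsingObservable D criticalFKIsingParam e := by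
  classical
  rw [fkIsingObservable_eq_sum hD]
  unfold vertexObsOn famZ
  refine Finset.sum_congr rfl fun ω _ => ?_
  rw [Complex.real_smul]
  rfl

open scoped Classical in
/-- **Lemma 4.1 for the family dart observable**: it lies on the line `quarterPhase (dartDir c₀ q) ℝ`.
[cite: Smirnov2010, Lemma 4.1] -/
theorem dartObsOn_mem_line (C : Finset (Finset (Sym2 (meshDomain D.Ω D.δ)))) (q : Site 2 × Fin 4) :
    ∃ t : ℝ, dartObsOn D hD C q = t * quarterPhase (dartDir (DiscreteDobrushin.startCorner hD) q) := by
  unfold dartObsOn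
  refine exists_real_sum _ _ _ fun ω _ => ?_
  obtain ⟨t, ht⟩ := dartSum_mem_line hD ω q
  exact ⟨rcWeight D.interfaceGraph criticalFKIsingParam 2 (Subtype.val ⁻¹' D.zdArcA) ω / famZ D C * t, by
    rw [ht]; push_cast; ring⟩

open scoped Classical in
/-- `‖dartObsOn C q‖ ≤ 1` for a nonempty family. [cite: Smirnov2010, §2.2] -/
theorem norm_dartObsOn_le_one {C : Finset (Finset (Sym2 (meshDomain D.Ω D.δ)))} (hC : C.Nonempty) (q : Site 2 × Fin 4) :
    ‖dartObsOn D hD C q‖ ≤ 1 := by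
  unfold dartObsOn
  refine (norm_sum_le _ _).trans ?_
  calc _ ≤ ∑ ω ∈ C, rcWeight D.interfaceGraph criticalFKIsingParam 2 (Subtype.val ⁻¹' D.zdArcA) ω / famZ D C := by
        refine Finset.sum_le_sum fun ω _ => ?_
        rw [norm_mul, Complex.norm_real, Real.norm_of_nonneg (weight_div_famZ_nonneg C ω)]
        exact mul_le_of_le_one_right (weight_div_famZ_nonneg C ω) (norm_dartSum_le_one hD ω q)
    _ = 1 := sum_weight_div_famZ hC

open scoped Classical in
/-- `0 ≤ dartFluxOn`. [cite: Smirnov2010, Remark 3.9] -/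
theorem dartFluxOn_nonneg (C : Finset (Finset (Sym2 (meshDomain D.Ω D.δ)))) (q : Site 2 × Fin 4) :
    0 ≤ dartFluxOn D hD C q := sq_nonneg _

open scoped Classical in
/-- `dartFluxOn ≤ 1` for a nonempty family. [cite: Smirnov2010, §2.2] -/
theorem dartFluxOn_le_one {C : Finset (Finset (Sym2 (meshDomain D.Ω D.δ)))} (hC : C.Nonempty) (q : Site 2 × Fin 4) :
    dartFluxOn D hD C q ≤ 1 := by
  unfold dartFluxOn
  have h := norm_dartObsOn_le_one hD hC q
  have h0 := norm_nonneg (dartObsOn D hD C q)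
  nlinarith

open scoped Classical in
/-- **Darts at `B`-sites vanish** for every family. [cite: Smirnov2010, Lemma 3.10 and Lemma 4.11] -/
theorem dartObsOn_eq_zero_of_mem_zdArcB (C : Finset (Finset (Sym2 (meshDomain D.Ω D.δ)))) {q : Site 2 × Fin 4}
    (hq : q.1 ∈ D.zdArcB) : dartObsOn D hD C q = 0 := by
  unfold dartObsOn
  exact Finset.sum_eq_zero fun ω _ => by rw [dartSum_eq_zero_of_mem_zdArcB hD ω hq, mul_zero]

open scoped Classical in
/-- Zero flux at `B`-sites. [cite: Smirnov2010, Lemma 3.10 and Lemma 4.11] -/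
theorem dartFluxOn_eq_zero_of_mem_zdArcB (C : Finset (Finset (Sym2 (meshDomain D.Ω D.δ)))) {q : Site 2 × Fin 4}
    (hq : q.1 ∈ D.zdArcB) : dartFluxOn D hD C q = 0 := by
  rw [dartFluxOn, dartObsOn_eq_zero_of_mem_zdArcB hD C hq, norm_zero, zero_pow two_ne_zero]

open scoped Classical in
/-- **The start dart is `1`** for every nonempty family. [cite: Smirnov2010, proof of Lemma 4.11] -/
theorem dartObsOn_startCorner {C : Finset (Finset (Sym2 (meshDomain D.Ω D.δ)))} (hC : C.Nonempty) :
    dartObsOn D hD C (DiscreteDobrushin.startCorner hD) = 1 := by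
  unfold dartObsOn
  rw [Finset.sum_congr rfl fun ω _ => by rw [dartSum_startCorner hD ω, mul_one], ← Complex.ofReal_sum, sum_weight_div_famZ hC,
    Complex.ofReal_one]

open scoped Classical in
/-- Unit flux at the start dart. [cite: Smirnov2010, Lemma 4.11] -/
theorem dartFluxOn_startCorner {C : Finset (Finset (Sym2 (meshDomain D.Ω D.δ)))} (hC : C.Nonempty) :
    dartFluxOn D hD C (DiscreteDobrushin.startCorner hD) = 1 := by
  rw [dartFluxOn, dartObsOn_startCorner hD hC, norm_one, one_pow]

open scoped Classical in
/-- **Following an edge forced open in the family**: if `cTgt q` is open in the completed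
configuration of every member of `C` (an `A`–`A` edge, or a revealed open edge of a prefix) and
`q` has an inner face, then `dartObsOn C q⁺ = quarterPhase (-1) · dartObsOn C q` for the forced
successor `q⁺`. [cite: Smirnov2010, Lemma 4.11] -/
theorem dartObsOn_follow_of_forall_mem (C : Finset (Finset (Sym2 (meshDomain D.Ω D.δ)))) {q : Site 2 × Fin 4}
    (hqf : D.IsInnerFace (cFace q)) (hopen : ∀ ω ∈ C, cTgt q ∈ D.bcBondConfig (liftConfig D.Ω D.δ ω)) :
    dartObsOn D hD C (q.1 + cornerUnit (q.2 + 1), q.2 + 3) = quarterPhase (-1) * dartObsOn D hD C q := by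
  unfold dartObsOn
  rw [Finset.mul_sum]
  refine Finset.sum_congr rfl fun ω hω => ?_
  rw [dartSum_follow hD ω hqf (hopen ω hω)]; ring

open scoped Classical in
/-- **Crossing an edge forced closed in the family** (an edge touching `B`, or a revealed closed
edge of a prefix): `dartObsOn C (q.1, q.2 + 1) = quarterPhase 1 · dartObsOn C q`.
[cite: Smirnov2010, Lemma 4.11] -/
theorem dartObsOn_cross_of_forall_not_mem (C : Finset (Finset (Sym2 (meshDomain D.Ω D.δ)))) {q : Site 2 × Fin 4}
    (hqf : D.IsInnerFace (cFace q)) (hq'f : D.IsInnerFace (faceAt q.1 (q.2 + 1)))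
    (hclosed : ∀ ω ∈ C, cTgt q ∉ D.bcBondConfig (liftConfig D.Ω D.δ ω)) :
    dartObsOn D hD C (q.1, q.2 + 1) = quarterPhase 1 * dartObsOn D hD C q := by
  unfold dartObsOn
  rw [Finset.mul_sum]
  refine Finset.sum_congr rfl fun ω hω => ?_
  rw [dartSum_cross hD ω hqf hq'f (hclosed ω hω)]; ring

open scoped Classical in
/-- Equal fluxes across an edge forced open in the family. [cite: Smirnov2010, Lemma 4.11] -/
theorem dartFluxOn_follow_eq (C : Finset (Finset (Sym2 (meshDomain D.Ω D.δ)))) {q : Site 2 × Fin 4}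
    (hqf : D.IsInnerFace (cFace q)) (hopen : ∀ ω ∈ C, cTgt q ∈ D.bcBondConfig (liftConfig D.Ω D.δ ω)) :
    dartFluxOn D hD C (q.1 + cornerUnit (q.2 + 1), q.2 + 3) = dartFluxOn D hD C q := by
  unfold dartFluxOn
  rw [dartObsOn_follow_of_forall_mem hD C hqf hopen, norm_mul, norm_quarterPhase, one_mul]

open scoped Classical in
/-- Equal fluxes across an edge forced closed in the family. [cite: Smirnov2010, Lemma 4.11] -/
theorem dartFluxOn_cross_eq (C : Finset (Finset (Sym2 (meshDomain D.Ω D.δ)))) {q : Site 2 × Fin 4}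
    (hqf : D.IsInnerFace (cFace q)) (hq'f : D.IsInnerFace (faceAt q.1 (q.2 + 1)))
    (hclosed : ∀ ω ∈ C, cTgt q ∉ D.bcBondConfig (liftConfig D.Ω D.δ ω)) :
    dartFluxOn D hD C (q.1, q.2 + 1) = dartFluxOn D hD C q := by
  unfold dartFluxOn
  rw [dartObsOn_cross_of_forall_not_mem hD C hqf hq'f hclosed, norm_mul, norm_quarterPhase, one_mul]

end Basic

/-! ### Lemma 4.5 on families closed under toggling an edge -/

section Toggle

variable [Fintype (meshDomain D.Ω D.δ)]

open scoped Classical in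
/-- The family `C` is **closed under toggling the edge `e`**: with `ω` it contains `ω ∪ {e}` and
`ω ∖ {e}` (a prefix cylinder is closed under toggling every unexplored edge). [cite: Smirnov2010, proof of Lemma 4.5] -/
def IsToggleClosed (C : Finset (Finset (Sym2 (meshDomain D.Ω D.δ)))) (e : Sym2 (meshDomain D.Ω D.δ)) : Prop :=
  ∀ ω ∈ C, insert e ω ∈ C ∧ ω.erase e ∈ C

open scoped Classical in
/-- The family of all configurations is closed under toggling every edge of the interface graph.
[cite: Smirnov2010, proof of Lemma 4.5] -/
theorem isToggleClosed_powerset {e : Sym2 (meshDomain D.Ω D.δ)} (he : e ∈ D.interfaceGraph.edgeFinset) :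
    IsToggleClosed D.interfaceGraph.edgeFinset.powerset e := fun ω hω => by
  rw [Finset.mem_powerset] at hω ⊢
  exact ⟨Finset.insert_subset he hω, Finset.mem_powerset.2 ((Finset.erase_subset _ _).trans hω)⟩

omit [Fintype (meshDomain D.Ω D.δ)] in
open scoped Classical in
/-- **Pairing the configurations of a toggle-closed family** along `ω ↦ ω ∪ {e}`:
`∑_{ω ∈ C} f ω = ∑_{ω ∈ C, e ∉ ω} (f ω + f (ω ∪ {e}))`. [cite: Smirnov2010, proof of Lemma 4.5] -/
theorem sum_toggle_pair {C : Finset (Finset (Sym2 (meshDomain D.Ω D.δ)))} {e : Sym2 (meshDomain D.Ω D.δ)}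
    (hC : IsToggleClosed C e) {M : Type*} [AddCommMonoid M] (f : Finset (Sym2 (meshDomain D.Ω D.δ)) → M) :
    ∑ ω ∈ C, f ω = ∑ ω ∈ C.filter (fun ω => e ∉ ω), (f ω + f (insert e ω)) := by
  classical
  rw [Finset.sum_add_distrib]
  have hsplit := (Finset.sum_filter_add_sum_filter_not C (fun ω => e ∉ ω) f).symm
  rw [hsplit]
  congr 1
  have himage : C.filter (fun ω => ¬ e ∉ ω) = (C.filter (fun ω => e ∉ ω)).image (insert e) := by
    ext ω
    simp only [Finset.mem_filter, not_not, Finset.mem_image]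
    constructor
    · rintro ⟨hω, heω⟩
      exact ⟨ω.erase e, ⟨(hC ω hω).2, Finset.notMem_erase _ _⟩, Finset.insert_erase heω⟩
    · rintro ⟨ω', ⟨hω', he'⟩, rfl⟩
      exact ⟨(hC ω' hω').1, Finset.mem_insert_self _ _⟩
  rw [himage, Finset.sum_image]
  intro ω₁ h₁ ω₂ h₂ heq
  rw [Finset.coe_filter] at h₁ h₂
  have : (insert e ω₁).erase e = (insert e ω₂).erase e := by rw [heq]
  rwa [Finset.erase_insert h₁.2, Finset.erase_insert h₂.2] at this

open scoped Classical in
/-- **Summing the pair identities over a toggle-closed family** (Smirnov 2010, proof of Lemma 4.5,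
`sum_weighted_arrivalSum_free` for a sub-family): the weighted arrival sums over the configurations
of a family closed under toggling `e = cTgt p` add up to zero — for `e` an edge of the interface
graph, not `A`–`A`, with both faces inner. [cite: Smirnov2010, proof of Lemma 4.5] -/
theorem sum_weighted_arrivalSum_on (hD : D.IsZdAdmissible)
    (hA : ((discreteDomainGraph D.Ω D.δ).induce D.zdArcA).Preconnected) {p : Site 2 × Fin 4}
    (hpf : D.IsInnerFace (cFace p)) (hp₂f : D.IsInnerFace (cFace (cornerPartner p)))
    (φ : ℤ → ℂ) (hφ1 : ∀ a : ℂ, (Real.sqrt 2 : ℂ) * (a * φ 1) + (a * φ (-1) + a * eighthPhase 4 * φ (-1)) = 0)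
    (hφ2 : ∀ a : ℂ, a * φ 1 + a * eighthPhase (-4) * φ 1 + (Real.sqrt 2 : ℂ) * (a * φ (-1)) = 0)
    {u v : meshDomain D.Ω D.δ} (hu : u.val = p.1) (hv : v.val = p.1 + cornerUnit (p.2 + 1))
    (heG : s(u, v) ∈ D.interfaceGraph.edgeFinset) (hpA : ¬ (p.1 ∈ D.zdArcA ∧ p.1 + cornerUnit (p.2 + 1) ∈ D.zdArcA))
    {C : Finset (Finset (Sym2 (meshDomain D.Ω D.δ)))} (hCsub : C ⊆ D.interfaceGraph.edgeFinset.powerset)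
    (hC : IsToggleClosed C s(u, v)) :
    ∑ ω ∈ C, (rcWeight D.interfaceGraph criticalFKIsingParam 2 (Subtype.val ⁻¹' D.zdArcA) ω : ℂ) *
        arrivalSum φ (D.bcBondConfig (liftConfig D.Ω D.δ ω)) (DiscreteDobrushin.startCorner hD) p
          (DiscreteDobrushin.exitTime hD (liftConfig D.Ω D.δ ω)) = 0 := by
  rw [sum_toggle_pair hC]
  refine Finset.sum_eq_zero fun ω hω => ?_
  rw [Finset.mem_filter] at hω
  have hωE : ω ⊆ D.interfaceGraph.edgeFinset := Finset.mem_powerset.1 (hCsub hω.1)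
  exact pair_weighted_free hD hA medialCycle_separates_holds medialCycle_turning_holds hpf hp₂f φ hφ1 hφ2 hu hv heG hpA hωE hω.2

open scoped Classical in
/-- **The incoming identity for a toggle-closed family** (Lemma 4.5, "`F(N) + F(S) = F(v)`"): at an
edge `e = cTgt p` of `Ω_δ` with no endpoint on `B`, not `A`–`A`, both faces inner, for a family
closed under toggling `e`, the family dart observables of the two corners arriving at `e` add up to
`κ` times the family vertex observable at `e`. [cite: Smirnov2010, Lemma 4.5 with Remarks 4.6–4.7] -/
theorem dartObsOn_add_partner (hD : D.IsZdAdmissible)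
    (hA : ((discreteDomainGraph D.Ω D.δ).induce D.zdArcA).Preconnected) {p : Site 2 × Fin 4}
    (he : cTgt p ∈ (discreteDomainGraph D.Ω D.δ).edgeSet) (hB : ∀ x ∈ cTgt p, x ∉ D.zdArcB)
    (hpA : ¬ (p.1 ∈ D.zdArcA ∧ p.1 + cornerUnit (p.2 + 1) ∈ D.zdArcA))
    (hpf : D.IsInnerFace (cFace p)) (hp₂f : D.IsInnerFace (cFace (cornerPartner p)))
    {C : Finset (Finset (Sym2 (meshDomain D.Ω D.δ)))} (hCsub : C ⊆ D.interfaceGraph.edgeFinset.powerset)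
    (hC : ∀ u v : meshDomain D.Ω D.δ, u.val = p.1 → v.val = p.1 + cornerUnit (p.2 + 1) → IsToggleClosed C s(u, v)) :
    dartObsOn D hD C p + dartObsOn D hD C (cornerPartner p) = kappa * vertexObsOn D hD C (cTgt p) := by
  obtain ⟨u, v, hu, hv, heG⟩ := free_data he hB
  have hS := sum_weighted_arrivalSum_on hD hA hpf hp₂f (fun s => 1 - kappa * eighthPhase s)
    (fun a => table_case1 a) (fun a => table_case2 a) hu hv heG hpA hCsub (hC u v hu hv)
  simp only [arrivalSum_in_eq hD hB] at hS
  unfold dartObsOn vertexObsOn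
  rw [← Finset.sum_add_distrib, Finset.mul_sum, ← sub_eq_zero, ← Finset.sum_sub_distrib]
  have key : ∀ ω ∈ C,
      ((((rcWeight D.interfaceGraph criticalFKIsingParam 2 (Subtype.val ⁻¹' D.zdArcA) ω / famZ D C : ℝ)) : ℂ) * dartSum D hD ω p +
        (((rcWeight D.interfaceGraph criticalFKIsingParam 2 (Subtype.val ⁻¹' D.zdArcA) ω / famZ D C : ℝ)) : ℂ) *
          dartSum D hD ω (cornerPartner p) -
        kappa * ((((rcWeight D.interfaceGraph criticalFKIsingParam 2 (Subtype.val ⁻¹' D.zdArcA) ω / famZ D C : ℝ)) : ℂ) *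
          passageSum (explorationList (D.bcBondConfig (liftConfig D.Ω D.δ ω)) (DiscreteDobrushin.startCorner hD)
            (DiscreteDobrushin.exitTime hD (liftConfig D.Ω D.δ ω))) D.δ (1 / 2) (cTgt p))) =
      ((famZ D C)⁻¹ : ℂ) * ((rcWeight D.interfaceGraph criticalFKIsingParam 2 (Subtype.val ⁻¹' D.zdArcA) ω : ℂ) *
        (dartSum D hD ω p + dartSum D hD ω (cornerPartner p) -
          kappa * passageSum (explorationList (D.bcBondConfig (liftConfig D.Ω D.δ ω)) (DiscreteDobrushin.startCorner hD)
            (DiscreteDobrushin.exitTime hD (liftConfig D.Ω D.δ ω))) D.δ (1 / 2) (cTgt p))) := by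
    intro ω _
    push_cast
    ring
  rw [Finset.sum_congr rfl key, ← Finset.mul_sum]
  unfold dartSum
  rw [hS, mul_zero]

open scoped Classical in
/-- **The outgoing identity for a toggle-closed family** (Lemma 4.5, "`F(E) + F(W) = F(v)`").
[cite: Smirnov2010, Lemma 4.5 with Remarks 4.6–4.7] -/
theorem dartObsOn_out (hD : D.IsZdAdmissible)
    (hA : ((discreteDomainGraph D.Ω D.δ).induce D.zdArcA).Preconnected) {p : Site 2 × Fin 4}
    (he : cTgt p ∈ (discreteDomainGraph D.Ω D.δ).edgeSet) (hB : ∀ x ∈ cTgt p, x ∉ D.zdArcB)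
    (hpA : ¬ (p.1 ∈ D.zdArcA ∧ p.1 + cornerUnit (p.2 + 1) ∈ D.zdArcA))
    (hpf : D.IsInnerFace (cFace p)) (hp₂f : D.IsInnerFace (cFace (cornerPartner p)))
    {C : Finset (Finset (Sym2 (meshDomain D.Ω D.δ)))} (hCsub : C ⊆ D.interfaceGraph.edgeFinset.powerset)
    (hC : ∀ u v : meshDomain D.Ω D.δ, u.val = p.1 → v.val = p.1 + cornerUnit (p.2 + 1) → IsToggleClosed C s(u, v)) :
    dartObsOn D hD C (p.1, p.2 + 1) + dartObsOn D hD C (p.1 + cornerUnit (p.2 + 1), p.2 + 3) =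
      kappa * vertexObsOn D hD C (cTgt p) := by
  obtain ⟨u, v, hu, hv, heG⟩ := free_data he hB
  have hφ1 : ∀ a : ℂ, (Real.sqrt 2 : ℂ) * (a * (fun s : ℤ => eighthPhase (2 * s) - kappa * eighthPhase s) 1) +
      (a * (fun s : ℤ => eighthPhase (2 * s) - kappa * eighthPhase s) (-1) +
        a * eighthPhase 4 * (fun s : ℤ => eighthPhase (2 * s) - kappa * eighthPhase s) (-1)) = 0 := by
    intro a; simpa using table_case1_out a
  have hφ2 : ∀ a : ℂ, a * (fun s : ℤ => eighthPhase (2 * s) - kappa * eighthPhase s) 1 +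
      a * eighthPhase (-4) * (fun s : ℤ => eighthPhase (2 * s) - kappa * eighthPhase s) 1 +
        (Real.sqrt 2 : ℂ) * (a * (fun s : ℤ => eighthPhase (2 * s) - kappa * eighthPhase s) (-1)) = 0 := by
    intro a; simpa using table_case2_out a
  have hS := sum_weighted_arrivalSum_on hD hA hpf hp₂f (fun s => eighthPhase (2 * s) - kappa * eighthPhase s)
    hφ1 hφ2 hu hv heG hpA hCsub (hC u v hu hv)
  simp only [arrivalSum_out_eq hD hB] at hS
  unfold dartObsOn vertexObsOn
  rw [← Finset.sum_add_distrib, Finset.mul_sum, ← sub_eq_zero, ← Finset.sum_sub_distrib]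
  have key : ∀ ω ∈ C,
      ((((rcWeight D.interfaceGraph criticalFKIsingParam 2 (Subtype.val ⁻¹' D.zdArcA) ω / famZ D C : ℝ)) : ℂ) *
          dartSum D hD ω (p.1, p.2 + 1) +
        (((rcWeight D.interfaceGraph criticalFKIsingParam 2 (Subtype.val ⁻¹' D.zdArcA) ω / famZ D C : ℝ)) : ℂ) *
          dartSum D hD ω (p.1 + cornerUnit (p.2 + 1), p.2 + 3) -
        kappa * ((((rcWeight D.interfaceGraph criticalFKIsingParam 2 (Subtype.val ⁻¹' D.zdArcA) ω / famZ D C : ℝ)) : ℂ) *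
          passageSum (explorationList (D.bcBondConfig (liftConfig D.Ω D.δ ω)) (DiscreteDobrushin.startCorner hD)
            (DiscreteDobrushin.exitTime hD (liftConfig D.Ω D.δ ω))) D.δ (1 / 2) (cTgt p))) =
      ((famZ D C)⁻¹ : ℂ) * ((rcWeight D.interfaceGraph criticalFKIsingParam 2 (Subtype.val ⁻¹' D.zdArcA) ω : ℂ) *
        (dartSum D hD ω (p.1, p.2 + 1) + dartSum D hD ω (p.1 + cornerUnit (p.2 + 1), p.2 + 3) -
          kappa * passageSum (explorationList (D.bcBondConfig (liftConfig D.Ω D.δ ω)) (DiscreteDobrushin.startCorner hD)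
            (DiscreteDobrushin.exitTime hD (liftConfig D.Ω D.δ ω))) D.δ (1 / 2) (cTgt p))) := by
    intro ω _
    push_cast
    ring
  rw [Finset.sum_congr rfl key, ← Finset.mul_sum]
  unfold dartSum
  rw [hS, mul_zero]

end Toggle

/-! ### The family fluxes: Pythagoras and closedness at toggle-closed edges -/

section Flux

variable [Fintype (meshDomain D.Ω D.δ)] (hD : D.IsZdAdmissible)

open scoped Classical in
/-- The fluxes of two darts two faces apart (orthogonal lines, Lemma 4.1) add up to the squared
norm of the sum of their family observables. [cite: Smirnov2010, Lemma 4.1] -/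
theorem dartFluxOn_add_of_snd_eq (C : Finset (Finset (Sym2 (meshDomain D.Ω D.δ)))) (q q' : Site 2 × Fin 4)
    (h : q'.2 = q.2 + 2) :
    dartFluxOn D hD C q + dartFluxOn D hD C q' = ‖dartObsOn D hD C q + dartObsOn D hD C q'‖ ^ 2 := by
  obtain ⟨t, ht⟩ := dartObsOn_mem_line hD C q
  obtain ⟨t', ht'⟩ := dartObsOn_mem_line hD C q'
  have hη : ‖quarterPhase (dartDir (DiscreteDobrushin.startCorner hD) q)‖ = 1 := norm_quarterPhase _
  unfold dartFluxOn
  rcases quarterPhase_dartDir_add_two (DiscreteDobrushin.startCorner hD) q q' h with h2 | h2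
  · rw [h2] at ht'
    exact (norm_sq_add_of_orthogonal_lines hη ht (Or.inl ht')).symm
  · rw [h2, mul_neg] at ht'
    exact (norm_sq_add_of_orthogonal_lines hη ht (Or.inr ht')).symm

open scoped Classical in
/-- **Lemma 3.6 at a toggle-closed interior edge: the family fluxes are closed.** At an edge
`e = cTgt p` of `Ω_δ` with no endpoint on `B`, not `A`–`A`, both faces inner, for a family closed
under toggling `e`, the fluxes of the two darts arriving at `e` and of the two darts leaving it have
the same sum `|κ F_C(e)|²`. [cite: Smirnov2010, Lemma 3.6 and its proof] -/
theorem dartFluxOn_closed_toggle (hA : ((discreteDomainGraph D.Ω D.δ).induce D.zdArcA).Preconnected) {p : Site 2 × Fin 4}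
    (he : cTgt p ∈ (discreteDomainGraph D.Ω D.δ).edgeSet) (hB : ∀ x ∈ cTgt p, x ∉ D.zdArcB)
    (hpA : ¬ (p.1 ∈ D.zdArcA ∧ p.1 + cornerUnit (p.2 + 1) ∈ D.zdArcA))
    (hpf : D.IsInnerFace (cFace p)) (hp₂f : D.IsInnerFace (cFace (cornerPartner p)))
    {C : Finset (Finset (Sym2 (meshDomain D.Ω D.δ)))} (hCsub : C ⊆ D.interfaceGraph.edgeFinset.powerset)
    (hC : ∀ u v : meshDomain D.Ω D.δ, u.val = p.1 → v.val = p.1 + cornerUnit (p.2 + 1) → IsToggleClosed C s(u, v)) :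
    dartFluxOn D hD C p + dartFluxOn D hD C (cornerPartner p) =
      dartFluxOn D hD C (p.1, p.2 + 1) + dartFluxOn D hD C (p.1 + cornerUnit (p.2 + 1), p.2 + 3) := by
  rw [dartFluxOn_add_of_snd_eq hD C p (cornerPartner p) rfl, dartObsOn_add_partner hD hA he hB hpA hpf hp₂f hCsub hC,
    dartFluxOn_add_of_snd_eq hD C (p.1, p.2 + 1) (p.1 + cornerUnit (p.2 + 1), p.2 + 3) (by simp only; omega),
    dartObsOn_out hD hA he hB hpA hpf hp₂f hCsub hC]

end Flux

/-! ### Edges adapted to a family; closedness of the flux form; the family primitive -/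

section Primitive

variable [Fintype (meshDomain D.Ω D.δ)] (hD : D.IsZdAdmissible)

open scoped Classical in
/-- The edge `e` of `ℤ²` is **forced open in the family** `C`: open in the completed configuration
of every member (the `A`–`A` edges of `Ω_δ`; the revealed open edges of a prefix cylinder).
[cite: Smirnov2010, Lemma 4.11] -/
def IsForcedOpen (C : Finset (Finset (Sym2 (meshDomain D.Ω D.δ)))) (e : Sym2 (Site 2)) : Prop :=
  ∀ ω ∈ C, e ∈ D.bcBondConfig (liftConfig D.Ω D.δ ω)

open scoped Classical in
/-- The edge `e` of `ℤ²` is **forced closed in the family** `C`: closed in the completed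
configuration of every member (the edges touching `B`; the revealed closed edges of a prefix
cylinder; edges outside `Ω_δ`). [cite: Smirnov2010, Lemma 4.11] -/
def IsForcedClosed (C : Finset (Finset (Sym2 (meshDomain D.Ω D.δ)))) (e : Sym2 (Site 2)) : Prop :=
  ∀ ω ∈ C, e ∉ D.bcBondConfig (liftConfig D.Ω D.δ ω)

open scoped Classical in
/-- The edge `e = cSrc (u, k)` is a **free edge of the family**: an edge of `Ω_δ` with no endpoint on
`B`, not `A`–`A`, under whose toggling the family is closed (the unexplored free edges of a prefix
cylinder). At such edges Lemma 4.5 holds for the family. [cite: Smirnov2010, Lemma 4.5] -/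
def IsFamilyFreeEdge (C : Finset (Finset (Sym2 (meshDomain D.Ω D.δ)))) (u : Site 2) (k : Fin 4) : Prop :=
  cSrc (u, k) ∈ (discreteDomainGraph D.Ω D.δ).edgeSet ∧ (∀ x ∈ cSrc (u, k), x ∉ D.zdArcB) ∧
    ¬ (u ∈ D.zdArcA ∧ u + cornerUnit k ∈ D.zdArcA) ∧
    ∀ a b : meshDomain D.Ω D.δ, a.val = u → b.val = u + cornerUnit k → IsToggleClosed C s(a, b)

open scoped Classical in
/-- The edge `e_k` at `u` is **adapted to the family** `C`: forced open, forced closed, or a free edge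
of the family. For a prefix cylinder every edge of `ℤ²` is adapted (revealed, unexplored, or never
available). [cite: Smirnov2010, Lemmas 4.5 and 4.11] -/
def IsAdaptedEdge (C : Finset (Finset (Sym2 (meshDomain D.Ω D.δ)))) (u : Site 2) (k : Fin 4) : Prop :=
  IsForcedOpen (D := D) C (cSrc (u, k)) ∨ IsForcedClosed (D := D) C (cSrc (u, k)) ∨ IsFamilyFreeEdge (D := D) C u k

omit [Fintype (meshDomain D.Ω D.δ)] in
/-- An `A`–`A` edge of `Ω_δ` is forced open in every family. [cite: Smirnov2001, §2] -/
theorem isForcedOpen_of_arcA (C : Finset (Finset (Sym2 (meshDomain D.Ω D.δ)))) {e : Sym2 (Site 2)}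
    (he : e ∈ (discreteDomainGraph D.Ω D.δ).edgeSet) (hAe : ∀ x ∈ e, x ∈ D.zdArcA) : IsForcedOpen (D := D) C e :=
  fun _ _ => forall_mem_bcBondConfig_of_arcA he hAe _

omit [Fintype (meshDomain D.Ω D.δ)] in
/-- An edge touching `B` is forced closed in every family. [cite: Smirnov2001, §2] -/
theorem isForcedClosed_of_mem_zdArcB (hD : D.IsZdAdmissible) (C : Finset (Finset (Sym2 (meshDomain D.Ω D.δ))))
    {e : Sym2 (Site 2)} {x : Site 2} (hx : x ∈ e) (hxB : x ∈ D.zdArcB) : IsForcedClosed (D := D) C e :=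
  fun _ _ => forall_not_mem_bcBondConfig_of_arcB hD hx hxB _

open scoped Classical in
/-- **The flux form of a family is closed on the inner faces** (Smirnov 2010, Lemma 3.6 for the
observable of a family): if every edge both of whose faces are inner is adapted to the family
(with (H1): the wired arc connected through `Ω_δ`), then going around such an edge through its four
squares the signed family fluxes cancel — free family edges by Lemma 4.5 and Pythagoras
(`dartFluxOn_closed_toggle`), forced edges by the correspondence of passages
(`dartFluxOn_follow_eq`, `dartFluxOn_cross_eq`). [cite: Smirnov2010, Lemma 3.6 with Lemmas 4.5 and 4.11] -/
theorem isCornerClosedOn_dartFluxOn (hA : ((discreteDomainGraph D.Ω D.δ).induce D.zdArcA).Preconnected)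
    {C : Finset (Finset (Sym2 (meshDomain D.Ω D.δ)))} (hCsub : C ⊆ D.interfaceGraph.edgeFinset.powerset)
    (hadapt : ∀ (u : Site 2) (k : Fin 4), D.IsInnerFace (faceAt u k) → D.IsInnerFace (faceAt u (k + 3)) →
      IsAdaptedEdge (D := D) C u k) :
    IsCornerClosedOn (dartFluxOn D hD C) D.innerFaces := by
  intro u k h₁ h₂
  rw [DiscreteDobrushin.mem_innerFaces_iff] at h₁ h₂
  have e31 : k + 3 + 1 = k := by omega
  have e32 : k + 3 + 2 = k + 1 := by omega
  have e33 : k + 3 + 3 = k + 2 := by omega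
  have e11 : k + 1 + 1 = k + 2 := by omega
  have e13 : k + 1 + 3 = k := by omega
  have htgt₁ : cTgt (u, k + 3) = cSrc (u, k) := cTgt_add_three u k
  have htgt₂ : cTgt (u + cornerUnit k, k + 1) = cSrc (u, k) := cTgt_add_cornerUnit_succ u k
  have hf₁ : D.IsInnerFace (cFace (u, k + 3)) := h₂
  have hf₂ : D.IsInnerFace (cFace (u + cornerUnit k, k + 1)) := by
    change D.IsInnerFace (faceAt (u + cornerUnit k) (k + 1)); rw [faceAt_add_unit_succ]; exact h₁
  unfold IsCornerClosedAt
  rcases hadapt u k h₁ h₂ with hopen | hclosed | hfree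
  · -- forced open: follow
    have c₁ := dartFluxOn_follow_eq hD C (q := (u, k + 3)) hf₁ (by rw [htgt₁]; exact hopen)
    have c₂ := dartFluxOn_follow_eq hD C (q := (u + cornerUnit k, k + 1)) hf₂ (by rw [htgt₂]; exact hopen)
    simp only [e31, e33, e11, e13] at c₁ c₂
    rw [cornerUnit_add_two, ← sub_eq_add_neg, add_sub_cancel_right] at c₂
    linarith
  · -- forced closed: cross
    have c₁ := dartFluxOn_cross_eq hD C (q := (u, k + 3)) hf₁ (by simp only [e31]; exact h₁) (by rw [htgt₁]; exact hclosed)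
    have c₂ := dartFluxOn_cross_eq hD C (q := (u + cornerUnit k, k + 1)) hf₂
      (by simp only [e11]; rw [faceAt_add_unit_add_two]; exact h₂) (by rw [htgt₂]; exact hclosed)
    simp only [e31, e11] at c₁ c₂
    linarith
  · -- a free edge of the family: Lemma 4.5
    obtain ⟨hz, hB, hAA, htog⟩ := hfree
    have hfree := dartFluxOn_closed_toggle hD hA (p := (u, k + 3)) (by rw [htgt₁]; exact hz)
      (by rw [htgt₁]; exact hB) (by simp only [e31]; exact hAA) hf₁
      (by change D.IsInnerFace (cFace (u + cornerUnit (k + 3 + 1), k + 3 + 2)); rw [e31, e32]; exact hf₂) hCsub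
      (by simp only [e31]; exact htog)
    change dartFluxOn D hD C (u, k + 3) + dartFluxOn D hD C (u + cornerUnit (k + 3 + 1), k + 3 + 2) =
      dartFluxOn D hD C (u, k + 3 + 1) + dartFluxOn D hD C (u + cornerUnit (k + 3 + 1), k + 3 + 3) at hfree
    simp only [e31, e32, e33] at hfree
    linarith

/-- **`(Hw, Hb)` is a discrete primitive of the family observable**: across every corner `q` of every
inner face, `Hb (cFace q) - Hw q.1 = |F_C(q)|² = dartFluxOn C q`. [cite: Smirnov2010, Lemma 3.6 eq. (3.3)] -/
def IsFamilyPrimitive (hD : D.IsZdAdmissible) (C : Finset (Finset (Sym2 (meshDomain D.Ω D.δ)))) (Hw Hb : Site 2 → ℝ) : Prop :=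
  ∀ q : Site 2 × Fin 4, D.IsInnerFace (cFace q) → Hb (cFace q) - Hw q.1 = dartFluxOn D hD C q

open scoped Classical in
/-- **Existence of the family primitive on hole-free domains** (the discrete Poincaré lemma
`exists_potential_of_holeFree` applied to the closed family flux form): for admissible data with
connected wired arc and hole-free inner faces, and a family to which every interior edge is
adapted, the family observable has a discrete primitive. [cite: Smirnov2010, Lemma 3.6] -/
theorem exists_isFamilyPrimitive (hA : ((discreteDomainGraph D.Ω D.δ).induce D.zdArcA).Preconnected)
    (hHF : HoleFree D.innerFaces) {C : Finset (Finset (Sym2 (meshDomain D.Ω D.δ)))}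
    (hCsub : C ⊆ D.interfaceGraph.edgeFinset.powerset)
    (hadapt : ∀ (u : Site 2) (k : Fin 4), D.IsInnerFace (faceAt u k) → D.IsInnerFace (faceAt u (k + 3)) →
      IsAdaptedEdge (D := D) C u k) :
    ∃ Hw Hb : Site 2 → ℝ, IsFamilyPrimitive hD C Hw Hb := by
  have hfin := D.innerFaces_finite hD.isBounded hD.delta_pos
  have hcoe : (↑hfin.toFinset : Set (Site 2)) = D.innerFaces := Set.Finite.coe_toFinset hfin
  obtain ⟨Hw, Hb, h⟩ := exists_potential_of_holeFree (dartFluxOn D hD C) hfin.toFinset (by rw [hcoe]; exact hHF)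
    (by rw [hcoe]; exact isCornerClosedOn_dartFluxOn hD hA hCsub hadapt)
  refine ⟨Hw, Hb, fun q hq => h q ?_⟩
  rw [mem_faceSetCorners, hcoe]
  exact hq

namespace IsFamilyPrimitive

variable {hD} {C : Finset (Finset (Sym2 (meshDomain D.Ω D.δ)))} {Hw Hb : Site 2 → ℝ}

/-- `H` increases from a site to its inner faces. [cite: Smirnov2010, Remark 3.9] -/
theorem hw_le_hb (h : IsFamilyPrimitive hD C Hw Hb) {v : Site 2} {k : Fin 4} (hf : D.IsInnerFace (faceAt v k)) :
    Hw v ≤ Hb (faceAt v k) := by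
  have := h (v, k) hf
  simp only [cFace] at this
  linarith [dartFluxOn_nonneg hD C (v, k)]

/-- **No jump at the free arc**: `Hb f = Hw b` for an inner face `f` at a `B`-site `b`. [cite: Smirnov2010, Lemma 3.10] -/
theorem hb_eq_hw_of_mem_zdArcB (h : IsFamilyPrimitive hD C Hw Hb) {b : Site 2} (hb : b ∈ D.zdArcB) {k : Fin 4}
    (hf : D.IsInnerFace (faceAt b k)) : Hb (faceAt b k) = Hw b := by
  have := h (b, k) hf
  simp only [cFace] at this
  rw [dartFluxOn_eq_zero_of_mem_zdArcB hD C (q := (b, k)) hb] at this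
  linarith

/-- **`Hw` is constant across an edge forced open in the family** whose face is inner (the wired arc,
and the wired bank of a prefix): `Hw u = Hw (u + e_k)`. [cite: Smirnov2010, Lemma 4.11] -/
theorem hw_eq_hw_of_forcedOpen (h : IsFamilyPrimitive hD C Hw Hb) {u : Site 2} {k : Fin 4}
    (hopen : IsForcedOpen (D := D) C (cSrc (u, k))) (hf : D.IsInnerFace (faceAt u k)) : Hw u = Hw (u + cornerUnit k) := by
  have p₁ := h (u, k) hf
  have hf₂ : D.IsInnerFace (faceAt (u + cornerUnit k) (k + 1)) := by rw [faceAt_add_unit_succ]; exact hf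
  have p₂ := h (u + cornerUnit k, k + 1) hf₂
  simp only [cFace] at p₁ p₂
  rw [faceAt_add_unit_succ] at p₂
  have c := dartFluxOn_follow_eq hD C (q := (u + cornerUnit k, k + 1)) hf₂ (by rw [cTgt_add_cornerUnit_succ]; exact hopen)
  have e13 : k + 1 + 3 = k := by omega
  have e11 : k + 1 + 1 = k + 2 := by omega
  simp only [e13, e11] at c
  rw [cornerUnit_add_two, ← sub_eq_add_neg, add_sub_cancel_right] at c
  linarith

/-- **The jump at the start**: `Hw (b'') = Hw (a) + 1` across the start dart, where `a = c₀.1` is the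
`A`-end of the start edge and `b''` the `B`-site at the other end of the source edge of `c₀`, for a
nonempty family. [cite: Smirnov2010, Lemma 4.11] -/
theorem jump_startCorner (h : IsFamilyPrimitive hD C Hw Hb) (hC : C.Nonempty) :
    Hw ((DiscreteDobrushin.startCorner hD).1 + cornerUnit (DiscreteDobrushin.startCorner hD).2) =
      Hw (DiscreteDobrushin.startCorner hD).1 + 1 := by
  set c₀ := DiscreteDobrushin.startCorner hD with hc₀
  have hsc : D.IsStartCorner c₀ := DiscreteDobrushin.isStartCorner_startCorner hD
  have hf : D.IsInnerFace (cFace c₀) := hsc.isOutEdge.1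
  have p₁ := h c₀ hf
  rw [dartFluxOn_startCorner hD hC] at p₁
  have hf' : D.IsInnerFace (faceAt (c₀.1 + cornerUnit c₀.2) (c₀.2 + 1)) := by rw [faceAt_add_unit_succ]; exact hf
  have p₂ := h.hb_eq_hw_of_mem_zdArcB hsc.mem_zdArcB hf'
  rw [faceAt_add_unit_succ] at p₂
  simp only [cFace] at p₁
  linarith

end IsFamilyPrimitive

end Primitive

end Literature.Probability.LatticeModels
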